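import Summits.BirchSwinnertonDyer.BirchSwinnertonDyer.Theorems.PrintCFramBottomClassIndexLawFiveLeParitySplitPrimitivityBinders
import Summits.BirchSwinnertonDyer.BirchSwinnertonDyer.Theorems.PrintCFramBottomClassIndexLawFiveLeEisensteinEndStateV19
import HarnessLib

/-!
# Crux `PrintCFram.BottomClassIndexLawFiveLe` (stmt-BirchSwinnertonDyer-20372), line `eisenstein-resource-bdp-line`, registry v19:
# END STATE v19 IN HEEGNER-POINT CURRENCY — crux ⟸ prints4 ∧ Kriz–Li Thm 1.20 ∧ C ∧ C♭_Ш ∧ B1-sha ∧ B1-prim (MAZUR–WILES-FREE),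
# and conversely crux ∧ (R-IMC)∃-Zp ⟹ B1-sha ∧ B1-prim: modulo print, the GL(1) supplies and the main-conjecture identity,
# THE CRUX IS «BSD_p when Ш[p] ≠ 0» ∧ «KOLYVAGIN p-PRIMITIVITY OF THE HEEGNER POINT when Ш[p] = 0» on the rank-one CM-ramified class

Cell `bsd-print-cfram`, width seat `bsd-line-cfram-p1-w3` g10, `--supports stmt-BirchSwinnertonDyer-20372` (helper). THEOREMS ONLY; no
definition, no named fact, no `sorry`. BSD is not proved by any of this; no summit statement is proved by this seat; no stub is closed; the
crux stays OPEN and is NOT claimed false. Sequel of `…ParitySplitPrimitivityBinders` (this seat: B1 VERBATIM ⟸ B1-sha ∧ B1-prim ∧ C♭_Ш,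
character-free, Mazur–Wiles-free; B1-prim necessary) composed with LEAD g11's END STATE v19
(`EisensteinEndStateV19.bottomClassIndexLawFiveLe_of_prints4_of_krizLi_of_classFactor_of_cover`: crux ⟸ prints4 ∧ KL ∧ B1 ∧ C) and with k7r-c4's
pointwise converse (`RamifiedSevenEllipticUnits.RubinFormulaZpBsdp.bsdp_of_ramifiedCMBottomClassIndexLawAtZp_of_imcZp`: crux's conclusion ∧ (R-IMC)∃-Zp ⟹
`BSD_p`). TEXTS (all character-free, Bernoulli-free, Selmer-count-free):

* **B1-sha** (LEAD g11) := «∀ rank-one class member `W` (CM, globally minimal, `CMRamified W p`, `p ≥ 5`) with `∃ s ∈ Ш(W/ℚ), s ≠ 0 ∧ p • s = 0`: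
  `BSDp W p`»;
* **B1-prim** (w3 g10) := «∀ rank-one class member `W` with `Ш(W/ℚ)[p] = 0`, ∀ admissible Heegner datum `(N = N_W, K, Dt, H, ι, P)` (`d_K` odd
  `< −4`, `L(W^{(d_K)},1) ≠ 0`), ∀ globally minimal model `Wd` of the twist with `Ш(Wd/ℚ)[p] = 0`: `padicValNat p [W(K):ℤP] = padicValNat p c`»
  (Kolyvagin's conjecture, first layer, up to the Manin-type constant, at an Eisenstein ADDITIVE prime);
* **C♭_Ш** (w3 g10) := «∀ rank-one class member `W` with `Ш(W/ℚ)[p] = 0`, ∃ imaginary quadratic `K` Heegner for `N_W`, `d_K` odd `< −4`,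
  `L(W^{(d_K)},1) ≠ 0`, and SOME globally minimal model `Wd` of the twist with `Ш(Wd/ℚ)[p] = 0`» (the B1-side twin of w5 g4's C_Ш; on the
  regular locus this is Stub C + the (α′) descent + Kriz–Li; new content only on the irregular locus);
* **C** = registry v19's `stub_heegnerField_of_unitClassFactor` (verbatim).

* §1 `bottomClassIndexLawFiveLe_of_prints4_of_krizLi_of_cover_of_twistSupply_of_sha_of_heegnerIndex` — **END STATE**: crux ⟸ prints4 ∧ KL ∧ C ∧
  C♭_Ш ∧ B1-sha ∧ B1-prim. FOUR refereed print facts + Kriz–Li Thm. 1.20 (no Mazur–Wiles, unlike the binder-pair END STATE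
  `EisensteinEndStateV19Binders.bottomClassIndexLawFiveLe_of_prints4_of_mazurWiles_of_krizLi_of_cover_of_level_of_sha`).
* §2 `heegnerIndex_of_bottomClassIndexLawFiveLe_of_imcZp`, `sha_of_bottomClassIndexLawFiveLe_of_imcZp` — NECESSITY: crux ∧ (R-IMC)∃-Zp ∧ prints4 ⟹
  B1-prim, resp. B1-sha.
* §3 `bottomClassIndexLawFiveLe_iff_sha_and_heegnerIndex` — **modulo prints4 ∧ KL ∧ C ∧ C♭_Ш ∧ (R-IMC)∃-Zp, crux ⟺ B1-sha ∧ B1-prim.**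
* Sequel `…EisensteinEndStateV19PrimitivityOffLocus` (same seat): both new hypotheses restricted to B1's own locus; B1-level ⟸ the Kolyvagin pair.

References: crux workfiles `Lines/eisenstein_resource_bdp_line.lean` (v19), `Lines/eisenstein-resource-bdp-line-lead-g11.md` §5 (the native-currency
reading: on B1 the CM zeta element `z(𝟙)` is imprimitive; on the Heegner side BSD predicts the point PRIMITIVE but `p`-adically invisible),
`…-w3g9-notes.md` §2(c). CONDITIONAL on everything displayed.
-/

open scoped Classical Pointwise

set_option linter.dupNamespace false
set_option autoImplicit false

noncomputable section

namespace Summit.BirchSwinnertonDyer.BirchSwinnertonDyer.Theorems.PrintCFram.EisensteinEndStateV19Primitivity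

open WeierstrassCurve NumberField
  Literature.NumberTheory.EllipticCurves
  Literature.NumberTheory.EllipticCurves.ModularForms
  Literature.NumberTheory.EllipticCurves.Rank1Residual
  Literature.NumberTheory.EllipticCurves.Rank1Residual.Typed
  Literature.NumberTheory.EllipticCurves.KrizLi2019
  Summit.BirchSwinnertonDyer.Rank1Residual
  Summit.BirchSwinnertonDyer.Rank1Residual.X12
  Summit.BirchSwinnertonDyer.BirchSwinnertonDyer.Theses.UniversalToricDescent
  Summit.BirchSwinnertonDyer.BirchSwinnertonDyer.Theorems
  Summit.BirchSwinnertonDyer.BirchSwinnertonDyer.Theorems.PrintCFram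

/-! ## §1 END STATE v19 in Heegner-point currency -/

/-- **END STATE v19 IN HEEGNER-POINT CURRENCY.** The crux `BottomClassIndexLawFiveLe` follows from: (1) `hprints4` — the FOUR print facts of
`stub_prints` (Hsieh 2014 Thm. A; Liu–Zhang–Zhang 2018; `ToricPublishedInputs` — Gross–Zagier I.(6.3)/(7.3), Kolyvagin, GZK, modularity, Cassels,
Heegner points; Burungale–Flach 2024 Cor. 2); (2) `hKL` — Kriz–Li 2019 Thm. 1.20; (3) `hC` — registry v19's Stub C (an admissible Heegner field with
unit field factor on the UNIT class-factor locus; GL(1)/ℚ); (4) `hSup` — **C♭_Ш**, the twist supply in Ш-currency (an admissible Heegner field with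
`L(W^{(d)},1) ≠ 0` and a `p`-regular twist, for every rank-one member with `Ш(W)[p] = 0`); and the TWO arithmetic statements (5) **B1-sha** —
`BSD_p` for every rank-one class member with `Ш(W/ℚ)[p] ≠ 0`; (6) **B1-prim** — on every rank-one class member with `Ш(W/ℚ)[p] = 0`, at every
admissible Heegner datum with a `p`-regular minimal twist model, the Heegner point is `p`-primitive up to the Manin-type constant. No Dirichlet
character, no Bernoulli number, no Selmer count in (4)–(6); NO Mazur–Wiles. Proof: `ParitySplit.stubB1_of_sha_of_heegnerIndex_of_twistSupply` gives
B1, then END STATE v19 (p673416). CONDITIONAL on (1)–(6); BSD is not proved by any of this; the crux stays OPEN.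
[cite: KrizLi2019, Thm. 1.20 (pp. 7–8), §8 (pp. 49–52)] [cite: GrossZagier1986, I.§4, Thm. I.(6.3) and V.§2 (pp. 310–312)] [cite: Kolyvagin1990, Thm. A]
[cite: BurungaleFlach2024, Thm. 1.1 and Cor. 2] [cite: BurungaleKobayashiNakamuraOta2026, §1.4 (arXiv:2608.06879 p. 8)] -/
theorem bottomClassIndexLawFiveLe_of_prints4_of_krizLi_of_cover_of_twistSupply_of_sha_of_heegnerIndex
    (hprints4 :
    Hsieh2014.thmA_exists_isHsiehLFunction_unrPeriod_anyLevel ∧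
    LiuZhangZhang2018.thm151_thm153_modularCurve_heegnerVector_additive ∧
    Summit.BirchSwinnertonDyer.BirchSwinnertonDyer.Theses.UniversalToricDescent.ToricPublishedInputs ∧
    bsdTriple_of_hasCM_of_L_one_ne_zero)
    (hKL : thm120_padicLogHeegner_unit_of_bernoulli)
    (hC :
    ∀ (W : WeierstrassCurve ℚ) [W.IsElliptic] [W.IsGloballyMinimal] (p : ℕ) [Fact p.Prime],
      W.HasCM → CMRamified W p → 5 ≤ p → W.analyticRank = 1 →
      ∀ (f : ℕ) [NeZero f] (ψ : DirichletCharacter ℚ_[p] f) (ω : DirichletCharacter ℚ_[p] p),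
        ψ.Odd → IsTeichmullerCharacter ω →
        (∀ ℓ : ℕ, ℓ.Prime → ¬ (ℓ ∣ p * W.conductorNorm ℤ) →
          ‖((W.LFunction ℓ : ℤ) : ℚ_[p]) - (ψ (ℓ : ZMod f) + ψ⁻¹ (ℓ : ZMod f) * ω (ℓ : ZMod p))‖ < 1) →
        ¬ ‖bernoulliOnePrim ψ⁻¹‖ ≤ (p : ℝ)⁻¹ →
        ∃ (K : Type) (_ : Field K) (_ : NumberField K) (εK : DirichletCharacter ℚ_[p] (NumberField.discr K).natAbs),
          IsImaginaryQuadratic K ∧ SatisfiesHeegnerHypothesis (W.conductorNorm ℤ) K ∧ Odd (NumberField.discr K) ∧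
          NumberField.discr K < -4 ∧ IsKroneckerCharacterOf K εK ∧
          ¬ ‖bernoulliOnePrim (bernoulliCharTwo ψ εK ω)‖ ≤ (p : ℝ)⁻¹)
    (hSup :
    ∀ (W : WeierstrassCurve ℚ) [W.IsElliptic] [W.IsGloballyMinimal] (p : ℕ) [Fact p.Prime],
      W.HasCM → CMRamified W p → 5 ≤ p → W.analyticRank = 1 →
      (∀ s ∈ W.sha, p • s = 0 → s = 0) →
      ∃ (K : Type) (_ : Field K) (_ : NumberField K),
        IsImaginaryQuadratic K ∧ SatisfiesHeegnerHypothesis (W.conductorNorm ℤ) K ∧ Odd (NumberField.discr K) ∧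
        NumberField.discr K < -4 ∧ (W.quadraticTwist (NumberField.discr K : ℚ)).entireLFunction 1 ≠ 0 ∧
        ∃ (Wd : WeierstrassCurve ℚ) (_ : Wd.IsElliptic) (_ : Wd.IsGloballyMinimal),
          (∃ C : VariableChange ℚ, C • W.quadraticTwist (NumberField.discr K : ℚ) = Wd) ∧
          ∀ s ∈ Wd.sha, p • s = 0 → s = 0)
    (hSha :
    ∀ (W : WeierstrassCurve ℚ) [W.IsElliptic] [W.IsGloballyMinimal] (p : ℕ) [Fact p.Prime],
      W.HasCM → CMRamified W p → 5 ≤ p → W.analyticRank = 1 →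
      (∃ s ∈ W.sha, s ≠ 0 ∧ p • s = 0) → BSDp W p)
    (hPrim :
    ∀ (W : WeierstrassCurve ℚ) [W.IsElliptic] [W.IsGloballyMinimal] (p : ℕ) [Fact p.Prime],
      W.HasCM → CMRamified W p → 5 ≤ p → W.analyticRank = 1 →
      (∀ s ∈ W.sha, p • s = 0 → s = 0) →
      ∀ (N : ℕ) [NeZero N] (K : Type) [Field K] [NumberField K]
        (Dt : ModularParametrizationData W N) (H : HeegnerDatum N (NumberField.discr K)) (ι : K →+* ℂ)
        (P : (W.baseChange K).toAffine.Point) (Wd : WeierstrassCurve ℚ) [Wd.IsElliptic] [Wd.IsGloballyMinimal],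
        W.conductorNorm ℤ = N → IsImaginaryQuadratic K → SatisfiesHeegnerHypothesis N K →
        Odd (NumberField.discr K) → NumberField.discr K < -4 →
        (W.quadraticTwist (NumberField.discr K : ℚ)).entireLFunction 1 ≠ 0 →
        WeierstrassCurve.Affine.Point.map ι.toRatAlgHom P = heegnerPointComplex Dt H →
        (∃ C : VariableChange ℚ, C • W.quadraticTwist (NumberField.discr K : ℚ) = Wd) →
        (∀ s ∈ Wd.sha, p • s = 0 → s = 0) →
        padicValNat p (AddSubgroup.zmultiples P).index = padicValNat p Dt.c.natAbs) :
    Summit.BirchSwinnertonDyer.BirchSwinnertonDyer.Theses.PrintCFram.BottomClassIndexLawFiveLe := by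
  obtain ⟨hGZ, hKo, hGZK, hmod, -, -, hGZ73, -, -, hHP⟩ := hprints4.2.2.1
  exact EisensteinEndStateV19.bottomClassIndexLawFiveLe_of_prints4_of_krizLi_of_classFactor_of_cover hprints4 hKL
    (ParitySplit.stubB1_of_sha_of_heegnerIndex_of_twistSupply hGZ hKo hGZK hmod hGZ73 hHP hprints4.2.2.2 hSha hPrim hSup) hC

/-! ## §2 Necessity: the crux, granted (R-IMC)∃-Zp and print, forces B1-prim and B1-sha -/

/-- **The crux ⟹ B1-prim** (granted the elliptic-unit main-conjecture identity (R-IMC)∃-Zp on the class, `hIMC`, and the print facts `hprints4`):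
the crux's conclusion with (R-IMC)∃-Zp and modularity / Gross–Zagier I.(7.3) / GZK / Cassels gives `BSD_p` on every rank-one class member (k7r-c4's
`RubinFormulaZpBsdp.bsdp_of_ramifiedCMBottomClassIndexLawAtZp_of_imcZp`, pointwise), and `BSD_p` on the class forces the Heegner index identity on the
branch `Ш(W)[p] = 0` with a `p`-regular twist (`ParitySplit.heegnerIndex_of_bsdp_rankOne`: Gross–Zagier I.(6.3), Kolyvagin, GZK, modularity, Gross–Zagier
I.(7.3), Burungale–Flach). So Kolyvagin `p`-primitivity on the class is NOT an artefact of the line: any proof of C2 (with IMC) proves it. CONDITIONAL;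
BSD is not proved by any of this. [cite: BurungaleKobayashiNakamuraOta2026, Thm. 3.14 (3) and §1.4 (arXiv:2608.06879 pp. 22–24, 8)]
[cite: GrossZagier1986, Thm. I.(6.3) and V.§2 (pp. 310–312)] [cite: Miller2011LMS, Def. 1.1 (arXiv:1010.2431 p. 3)] -/
theorem heegnerIndex_of_bottomClassIndexLawFiveLe_of_imcZp
    (hprints4 :
    Hsieh2014.thmA_exists_isHsiehLFunction_unrPeriod_anyLevel ∧
    LiuZhangZhang2018.thm151_thm153_modularCurve_heegnerVector_additive ∧
    Summit.BirchSwinnertonDyer.BirchSwinnertonDyer.Theses.UniversalToricDescent.ToricPublishedInputs ∧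
    bsdTriple_of_hasCM_of_L_one_ne_zero)
    (hIMC : ∀ (W : WeierstrassCurve ℚ) [W.IsElliptic] [W.IsGloballyMinimal] (p : ℕ) [Fact p.Prime],
      W.HasCM → CMRamified W p → 5 ≤ p → W.analyticRank = 1 → O11.RamifiedCMEllipticUnitIMCAtZp W p)
    (hcrux : Summit.BirchSwinnertonDyer.BirchSwinnertonDyer.Theses.PrintCFram.BottomClassIndexLawFiveLe) :
    ∀ (W : WeierstrassCurve ℚ) [W.IsElliptic] [W.IsGloballyMinimal] (p : ℕ) [Fact p.Prime],
      W.HasCM → CMRamified W p → 5 ≤ p → W.analyticRank = 1 →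
      (∀ s ∈ W.sha, p • s = 0 → s = 0) →
      ∀ (N : ℕ) [NeZero N] (K : Type) [Field K] [NumberField K]
        (Dt : ModularParametrizationData W N) (H : HeegnerDatum N (NumberField.discr K)) (ι : K →+* ℂ)
        (P : (W.baseChange K).toAffine.Point) (Wd : WeierstrassCurve ℚ) [Wd.IsElliptic] [Wd.IsGloballyMinimal],
        W.conductorNorm ℤ = N → IsImaginaryQuadratic K → SatisfiesHeegnerHypothesis N K →
        Odd (NumberField.discr K) → NumberField.discr K < -4 →
        (W.quadraticTwist (NumberField.discr K : ℚ)).entireLFunction 1 ≠ 0 →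
        WeierstrassCurve.Affine.Point.map ι.toRatAlgHom P = heegnerPointComplex Dt H →
        (∃ C : VariableChange ℚ, C • W.quadraticTwist (NumberField.discr K : ℚ) = Wd) →
        (∀ s ∈ Wd.sha, p • s = 0 → s = 0) →
        padicValNat p (AddSubgroup.zmultiples P).index = padicValNat p Dt.c.natAbs := by
  obtain ⟨hGZ, hKo, hGZK, hmod, -, hCassels, hGZ73, -⟩ := hprints4.2.2.1
  exact ParitySplit.heegnerIndex_of_bsdp_rankOne hGZ hKo hGZK hmod hGZ73 hprints4.2.2.2
    (fun W _ _ p _ hCM hram h5 hr ↦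
      RamifiedSevenEllipticUnits.RubinFormulaZpBsdp.bsdp_of_ramifiedCMBottomClassIndexLawAtZp_of_imcZp hmod hGZ73 hGZK hCassels
        (hIMC W p hCM hram h5 hr) hCM hram h5 hr (hcrux hGZK W p hCM hram h5 hr))

/-- **The crux ⟹ B1-sha** (granted (R-IMC)∃-Zp and the print facts): `BSD_p` on every rank-one class member (k7r-c4 pointwise), in particular on those
with `Ш(W/ℚ)[p] ≠ 0`. CONDITIONAL; BSD is not proved by any of this. [cite: BurungaleKobayashiNakamuraOta2026, Thm. 3.14 (3) and §1.4 (arXiv:2608.06879 pp. 22–24, 8)]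
[cite: Miller2011LMS, Def. 1.1 (arXiv:1010.2431 p. 3)] -/
theorem sha_of_bottomClassIndexLawFiveLe_of_imcZp
    (hprints4 :
    Hsieh2014.thmA_exists_isHsiehLFunction_unrPeriod_anyLevel ∧
    LiuZhangZhang2018.thm151_thm153_modularCurve_heegnerVector_additive ∧
    Summit.BirchSwinnertonDyer.BirchSwinnertonDyer.Theses.UniversalToricDescent.ToricPublishedInputs ∧
    bsdTriple_of_hasCM_of_L_one_ne_zero)
    (hIMC : ∀ (W : WeierstrassCurve ℚ) [W.IsElliptic] [W.IsGloballyMinimal] (p : ℕ) [Fact p.Prime],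
      W.HasCM → CMRamified W p → 5 ≤ p → W.analyticRank = 1 → O11.RamifiedCMEllipticUnitIMCAtZp W p)
    (hcrux : Summit.BirchSwinnertonDyer.BirchSwinnertonDyer.Theses.PrintCFram.BottomClassIndexLawFiveLe) :
    ∀ (W : WeierstrassCurve ℚ) [W.IsElliptic] [W.IsGloballyMinimal] (p : ℕ) [Fact p.Prime],
      W.HasCM → CMRamified W p → 5 ≤ p → W.analyticRank = 1 →
      (∃ s ∈ W.sha, s ≠ 0 ∧ p • s = 0) → BSDp W p := by
  obtain ⟨-, -, hGZK, hmod, -, hCassels, hGZ73, -⟩ := hprints4.2.2.1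
  intro W _ _ p _ hCM hram h5 hr _
  exact RamifiedSevenEllipticUnits.RubinFormulaZpBsdp.bsdp_of_ramifiedCMBottomClassIndexLawAtZp_of_imcZp hmod hGZ73 hGZK hCassels
    (hIMC W p hCM hram h5 hr) hCM hram h5 hr (hcrux hGZK W p hCM hram h5 hr)

/-! ## §3 The iff: modulo print, the GL(1) supplies and (R-IMC)∃-Zp, the crux IS «B1-sha ∧ B1-prim» -/

/-- **CRUX ⟺ B1-sha ∧ B1-prim, modulo prints4 ∧ Kriz–Li Thm. 1.20 ∧ C ∧ C♭_Ш ∧ (R-IMC)∃-Zp.** On this line, granted the four refereed print facts,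
Kriz–Li's theorem, the two GL(1) Heegner-field supplies (Stub C on the regular locus, C♭_Ш in Ш-currency) and the elliptic-unit main-conjecture identity on
the class, the crux `BottomClassIndexLawFiveLe` is EQUIVALENT to the conjunction of «`BSD_p` on the rank-one CM-ramified members with `Ш[p] ≠ 0`» and
«Kolyvagin `p`-primitivity of the Heegner point (up to the Manin-type constant) on the rank-one CM-ramified members with `Ш[p] = 0`, at every admissible
Heegner datum with a `p`-regular twist». (⟸) §1 (IMC not used); (⟹) §2 (KL, C, C♭_Ш not used). CONDITIONAL; BSD is not proved by any of this; the crux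
stays OPEN. [cite: KrizLi2019, Thm. 1.20 (pp. 7–8)] [cite: GrossZagier1986, Thm. I.(6.3) and V.§2 (pp. 310–312)]
[cite: BurungaleKobayashiNakamuraOta2026, Thm. 3.14 (3) and §1.4 (arXiv:2608.06879 pp. 22–24, 8)] [cite: BurungaleFlach2024, Thm. 1.1 and Cor. 2] -/
theorem bottomClassIndexLawFiveLe_iff_sha_and_heegnerIndex
    (hprints4 :
    Hsieh2014.thmA_exists_isHsiehLFunction_unrPeriod_anyLevel ∧
    LiuZhangZhang2018.thm151_thm153_modularCurve_heegnerVector_additive ∧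
    Summit.BirchSwinnertonDyer.BirchSwinnertonDyer.Theses.UniversalToricDescent.ToricPublishedInputs ∧
    bsdTriple_of_hasCM_of_L_one_ne_zero)
    (hKL : thm120_padicLogHeegner_unit_of_bernoulli)
    (hC :
    ∀ (W : WeierstrassCurve ℚ) [W.IsElliptic] [W.IsGloballyMinimal] (p : ℕ) [Fact p.Prime],
      W.HasCM → CMRamified W p → 5 ≤ p → W.analyticRank = 1 →
      ∀ (f : ℕ) [NeZero f] (ψ : DirichletCharacter ℚ_[p] f) (ω : DirichletCharacter ℚ_[p] p),
        ψ.Odd → IsTeichmullerCharacter ω →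
        (∀ ℓ : ℕ, ℓ.Prime → ¬ (ℓ ∣ p * W.conductorNorm ℤ) →
          ‖((W.LFunction ℓ : ℤ) : ℚ_[p]) - (ψ (ℓ : ZMod f) + ψ⁻¹ (ℓ : ZMod f) * ω (ℓ : ZMod p))‖ < 1) →
        ¬ ‖bernoulliOnePrim ψ⁻¹‖ ≤ (p : ℝ)⁻¹ →
        ∃ (K : Type) (_ : Field K) (_ : NumberField K) (εK : DirichletCharacter ℚ_[p] (NumberField.discr K).natAbs),
          IsImaginaryQuadratic K ∧ SatisfiesHeegnerHypothesis (W.conductorNorm ℤ) K ∧ Odd (NumberField.discr K) ∧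
          NumberField.discr K < -4 ∧ IsKroneckerCharacterOf K εK ∧
          ¬ ‖bernoulliOnePrim (bernoulliCharTwo ψ εK ω)‖ ≤ (p : ℝ)⁻¹)
    (hSup :
    ∀ (W : WeierstrassCurve ℚ) [W.IsElliptic] [W.IsGloballyMinimal] (p : ℕ) [Fact p.Prime],
      W.HasCM → CMRamified W p → 5 ≤ p → W.analyticRank = 1 →
      (∀ s ∈ W.sha, p • s = 0 → s = 0) →
      ∃ (K : Type) (_ : Field K) (_ : NumberField K),
        IsImaginaryQuadratic K ∧ SatisfiesHeegnerHypothesis (W.conductorNorm ℤ) K ∧ Odd (NumberField.discr K) ∧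
        NumberField.discr K < -4 ∧ (W.quadraticTwist (NumberField.discr K : ℚ)).entireLFunction 1 ≠ 0 ∧
        ∃ (Wd : WeierstrassCurve ℚ) (_ : Wd.IsElliptic) (_ : Wd.IsGloballyMinimal),
          (∃ C : VariableChange ℚ, C • W.quadraticTwist (NumberField.discr K : ℚ) = Wd) ∧
          ∀ s ∈ Wd.sha, p • s = 0 → s = 0)
    (hIMC : ∀ (W : WeierstrassCurve ℚ) [W.IsElliptic] [W.IsGloballyMinimal] (p : ℕ) [Fact p.Prime],
      W.HasCM → CMRamified W p → 5 ≤ p → W.analyticRank = 1 → O11.RamifiedCMEllipticUnitIMCAtZp W p) :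
    Summit.BirchSwinnertonDyer.BirchSwinnertonDyer.Theses.PrintCFram.BottomClassIndexLawFiveLe ↔
    ((∀ (W : WeierstrassCurve ℚ) [W.IsElliptic] [W.IsGloballyMinimal] (p : ℕ) [Fact p.Prime],
      W.HasCM → CMRamified W p → 5 ≤ p → W.analyticRank = 1 →
      (∃ s ∈ W.sha, s ≠ 0 ∧ p • s = 0) → BSDp W p) ∧
    (∀ (W : WeierstrassCurve ℚ) [W.IsElliptic] [W.IsGloballyMinimal] (p : ℕ) [Fact p.Prime],
      W.HasCM → CMRamified W p → 5 ≤ p → W.analyticRank = 1 →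
      (∀ s ∈ W.sha, p • s = 0 → s = 0) →
      ∀ (N : ℕ) [NeZero N] (K : Type) [Field K] [NumberField K]
        (Dt : ModularParametrizationData W N) (H : HeegnerDatum N (NumberField.discr K)) (ι : K →+* ℂ)
        (P : (W.baseChange K).toAffine.Point) (Wd : WeierstrassCurve ℚ) [Wd.IsElliptic] [Wd.IsGloballyMinimal],
        W.conductorNorm ℤ = N → IsImaginaryQuadratic K → SatisfiesHeegnerHypothesis N K →
        Odd (NumberField.discr K) → NumberField.discr K < -4 →
        (W.quadraticTwist (NumberField.discr K : ℚ)).entireLFunction 1 ≠ 0 →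
        WeierstrassCurve.Affine.Point.map ι.toRatAlgHom P = heegnerPointComplex Dt H →
        (∃ C : VariableChange ℚ, C • W.quadraticTwist (NumberField.discr K : ℚ) = Wd) →
        (∀ s ∈ Wd.sha, p • s = 0 → s = 0) →
        padicValNat p (AddSubgroup.zmultiples P).index = padicValNat p Dt.c.natAbs)) :=
  ⟨fun hcrux ↦ ⟨sha_of_bottomClassIndexLawFiveLe_of_imcZp hprints4 hIMC hcrux,
      heegnerIndex_of_bottomClassIndexLawFiveLe_of_imcZp hprints4 hIMC hcrux⟩,
    fun h ↦ bottomClassIndexLawFiveLe_of_prints4_of_krizLi_of_cover_of_twistSupply_of_sha_of_heegnerIndex hprints4 hKL hC hSup h.1 h.2⟩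

end Summit.BirchSwinnertonDyer.BirchSwinnertonDyer.Theorems.PrintCFram.EisensteinEndStateV19Primitivity

end
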